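import Summits.Ventures.PercRepro.G3Class

/-!
# The kernel chunks of the G₃ class sums, part A3 (p6, gen 6; split gen 7 for the gate's 600-s elaboration budget)

Sure-set groups `12`–`17` of the `G3ClassA` lineage: `iGroup_g` with contiguous segments of `subsetsS3`,
each theorem `classOK_g_j` a closed Boolean check of ≤ 2,200 values of `kA3` by `decide +kernel`, `mem_seg_g` (the segments
cover the sure sets, kernel) and the group dispatch `classOK_g`.  Statements, names and proofs are those of `G3ClassA`
(gen 6); only the file boundary changed.  Assembled in `G3ClassAll.lean`.
-/

-- the kernel chunks below are heavy; elaborate them one at a time (memory)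
set_option Elab.async false

namespace PercRepro

open Finset

/-- Sure-set group `12` (3 sets). -/
def iGroup12 : List (Finset (Fin 9)) :=
  [{1, 5}, {1, 6}, {1, 7}]

/-- Kernel chunk `12.0`: every `U` in this segment of `subsetsS3` passes `classOKpair I U` for all `I` of group `12`. -/ theorem classOK_12_0 : iGroup12.all (fun I => ((subsetsS3.drop 0).take 106).all (classOKpair I)) = true := by
  decide +kernel

/-- Kernel chunk `12.1`: every `U` in this segment of `subsetsS3` passes `classOKpair I U` for all `I` of group `12`. -/ theorem classOK_12_1 : iGroup12.all (fun I => ((subsetsS3.drop 106).take 150).all (classOKpair I)) = true := by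
  decide +kernel

/-- Every `U ⊆ S3` lies in one of the segments of `subsetsS3` used by group `12` (kernel-checked). -/ theorem mem_seg_12 : ∀ U : Finset (Fin 9), U ⊆ S3 → U ∈ (subsetsS3.drop 0).take 106 ∨ U ∈ (subsetsS3.drop 106).take 150 := by
  decide +kernel

/-- Class-level check for group `12`: all `(I, U)` with `I` in the group and `U ⊆ S3` pass `classOKpair`. -/ theorem classOK_12 : ∀ I ∈ iGroup12, ∀ U : Finset (Fin 9), U ⊆ S3 → classOKpair I U = true := by
  intro I hI U hU
  rcases mem_seg_12 U hU with h0 | h1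
  · exact List.all_eq_true.mp (List.all_eq_true.mp classOK_12_0 I hI) U h0
  · exact List.all_eq_true.mp (List.all_eq_true.mp classOK_12_1 I hI) U h1

/-- Sure-set group `13` (3 sets). -/
def iGroup13 : List (Finset (Fin 9)) :=
  [{1, 8}, {2, 4}, {2, 5}]

/-- Kernel chunk `13.0`: every `U` in this segment of `subsetsS3` passes `classOKpair I U` for all `I` of group `13`. -/ theorem classOK_13_0 : iGroup13.all (fun I => ((subsetsS3.drop 0).take 109).all (classOKpair I)) = true := by
  decide +kernel

/-- Kernel chunk `13.1`: every `U` in this segment of `subsetsS3` passes `classOKpair I U` for all `I` of group `13`. -/ theorem classOK_13_1 : iGroup13.all (fun I => ((subsetsS3.drop 109).take 147).all (classOKpair I)) = true := by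
  decide +kernel

/-- Every `U ⊆ S3` lies in one of the segments of `subsetsS3` used by group `13` (kernel-checked). -/ theorem mem_seg_13 : ∀ U : Finset (Fin 9), U ⊆ S3 → U ∈ (subsetsS3.drop 0).take 109 ∨ U ∈ (subsetsS3.drop 109).take 147 := by
  decide +kernel

/-- Class-level check for group `13`: all `(I, U)` with `I` in the group and `U ⊆ S3` pass `classOKpair`. -/ theorem classOK_13 : ∀ I ∈ iGroup13, ∀ U : Finset (Fin 9), U ⊆ S3 → classOKpair I U = true := by
  intro I hI U hU
  rcases mem_seg_13 U hU with h0 | h1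
  · exact List.all_eq_true.mp (List.all_eq_true.mp classOK_13_0 I hI) U h0
  · exact List.all_eq_true.mp (List.all_eq_true.mp classOK_13_1 I hI) U h1

/-- Sure-set group `14` (3 sets). -/
def iGroup14 : List (Finset (Fin 9)) :=
  [{2, 6}, {2, 7}, {2, 8}]

/-- Kernel chunk `14.0`: every `U` in this segment of `subsetsS3` passes `classOKpair I U` for all `I` of group `14`. -/ theorem classOK_14_0 : iGroup14.all (fun I => ((subsetsS3.drop 0).take 112).all (classOKpair I)) = true := by
  decide +kernel

/-- Kernel chunk `14.1`: every `U` in this segment of `subsetsS3` passes `classOKpair I U` for all `I` of group `14`. -/ theorem classOK_14_1 : iGroup14.all (fun I => ((subsetsS3.drop 112).take 144).all (classOKpair I)) = true := by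
  decide +kernel

/-- Every `U ⊆ S3` lies in one of the segments of `subsetsS3` used by group `14` (kernel-checked). -/ theorem mem_seg_14 : ∀ U : Finset (Fin 9), U ⊆ S3 → U ∈ (subsetsS3.drop 0).take 112 ∨ U ∈ (subsetsS3.drop 112).take 144 := by
  decide +kernel

/-- Class-level check for group `14`: all `(I, U)` with `I` in the group and `U ⊆ S3` pass `classOKpair`. -/ theorem classOK_14 : ∀ I ∈ iGroup14, ∀ U : Finset (Fin 9), U ⊆ S3 → classOKpair I U = true := by
  intro I hI U hU
  rcases mem_seg_14 U hU with h0 | h1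
  · exact List.all_eq_true.mp (List.all_eq_true.mp classOK_14_0 I hI) U h0
  · exact List.all_eq_true.mp (List.all_eq_true.mp classOK_14_1 I hI) U h1

/-- Sure-set group `15` (3 sets). -/
def iGroup15 : List (Finset (Fin 9)) :=
  [{4, 5}, {4, 6}, {4, 7}]

/-- Kernel chunk `15.0`: every `U` in this segment of `subsetsS3` passes `classOKpair I U` for all `I` of group `15`. -/ theorem classOK_15_0 : iGroup15.all (fun I => ((subsetsS3.drop 0).take 113).all (classOKpair I)) = true := by
  decide +kernel

/-- Kernel chunk `15.1`: every `U` in this segment of `subsetsS3` passes `classOKpair I U` for all `I` of group `15`. -/ theorem classOK_15_1 : iGroup15.all (fun I => ((subsetsS3.drop 113).take 143).all (classOKpair I)) = true := by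
  decide +kernel

/-- Every `U ⊆ S3` lies in one of the segments of `subsetsS3` used by group `15` (kernel-checked). -/ theorem mem_seg_15 : ∀ U : Finset (Fin 9), U ⊆ S3 → U ∈ (subsetsS3.drop 0).take 113 ∨ U ∈ (subsetsS3.drop 113).take 143 := by
  decide +kernel

/-- Class-level check for group `15`: all `(I, U)` with `I` in the group and `U ⊆ S3` pass `classOKpair`. -/ theorem classOK_15 : ∀ I ∈ iGroup15, ∀ U : Finset (Fin 9), U ⊆ S3 → classOKpair I U = true := by
  intro I hI U hU
  rcases mem_seg_15 U hU with h0 | h1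
  · exact List.all_eq_true.mp (List.all_eq_true.mp classOK_15_0 I hI) U h0
  · exact List.all_eq_true.mp (List.all_eq_true.mp classOK_15_1 I hI) U h1

/-- Sure-set group `16` (3 sets). -/
def iGroup16 : List (Finset (Fin 9)) :=
  [{4, 8}, {5, 6}, {5, 7}]

/-- Kernel chunk `16.0`: every `U` in this segment of `subsetsS3` passes `classOKpair I U` for all `I` of group `16`. -/ theorem classOK_16_0 : iGroup16.all (fun I => ((subsetsS3.drop 0).take 113).all (classOKpair I)) = true := by
  decide +kernel

/-- Kernel chunk `16.1`: every `U` in this segment of `subsetsS3` passes `classOKpair I U` for all `I` of group `16`. -/ theorem classOK_16_1 : iGroup16.all (fun I => ((subsetsS3.drop 113).take 143).all (classOKpair I)) = true := by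
  decide +kernel

/-- Every `U ⊆ S3` lies in one of the segments of `subsetsS3` used by group `16` (kernel-checked). -/ theorem mem_seg_16 : ∀ U : Finset (Fin 9), U ⊆ S3 → U ∈ (subsetsS3.drop 0).take 113 ∨ U ∈ (subsetsS3.drop 113).take 143 := by
  decide +kernel

/-- Class-level check for group `16`: all `(I, U)` with `I` in the group and `U ⊆ S3` pass `classOKpair`. -/ theorem classOK_16 : ∀ I ∈ iGroup16, ∀ U : Finset (Fin 9), U ⊆ S3 → classOKpair I U = true := by
  intro I hI U hU
  rcases mem_seg_16 U hU with h0 | h1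
  · exact List.all_eq_true.mp (List.all_eq_true.mp classOK_16_0 I hI) U h0
  · exact List.all_eq_true.mp (List.all_eq_true.mp classOK_16_1 I hI) U h1

/-- Sure-set group `17` (3 sets). -/
def iGroup17 : List (Finset (Fin 9)) :=
  [{5, 8}, {6, 7}, {6, 8}]

/-- Kernel chunk `17.0`: every `U` in this segment of `subsetsS3` passes `classOKpair I U` for all `I` of group `17`. -/ theorem classOK_17_0 : iGroup17.all (fun I => ((subsetsS3.drop 0).take 115).all (classOKpair I)) = true := by
  decide +kernel

/-- Kernel chunk `17.1`: every `U` in this segment of `subsetsS3` passes `classOKpair I U` for all `I` of group `17`. -/ theorem classOK_17_1 : iGroup17.all (fun I => ((subsetsS3.drop 115).take 141).all (classOKpair I)) = true := by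
  decide +kernel

/-- Every `U ⊆ S3` lies in one of the segments of `subsetsS3` used by group `17` (kernel-checked). -/ theorem mem_seg_17 : ∀ U : Finset (Fin 9), U ⊆ S3 → U ∈ (subsetsS3.drop 0).take 115 ∨ U ∈ (subsetsS3.drop 115).take 141 := by
  decide +kernel

/-- Class-level check for group `17`: all `(I, U)` with `I` in the group and `U ⊆ S3` pass `classOKpair`. -/ theorem classOK_17 : ∀ I ∈ iGroup17, ∀ U : Finset (Fin 9), U ⊆ S3 → classOKpair I U = true := by
  intro I hI U hU
  rcases mem_seg_17 U hU with h0 | h1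
  · exact List.all_eq_true.mp (List.all_eq_true.mp classOK_17_0 I hI) U h0
  · exact List.all_eq_true.mp (List.all_eq_true.mp classOK_17_1 I hI) U h1

end PercRepro
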